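import Mathlib
import Summits.NavierStokesRegularity.NavierStokesRegularity.Theses.TypeIQuarterGate
import Summits.NavierStokesRegularity.NavierStokesRegularity.Theses.ExtremalTypeIConstant
import Summits.NavierStokesRegularity.NavierStokesRegularity.Theorems.ExtremalTypeIConstantSelfSimilarExcluded
import Summits.NavierStokesRegularity.NavierStokesRegularity.Theorems.SqueezeCycleExtremalElementExistsExtraction
import Summits.NavierStokesRegularity.NavierStokesRegularity.Theorems.SymmetryModuliCountLinearLiouvilleSevenFiniteEnergy
import Summits.NavierStokesRegularity.NavierStokesRegularity.Theorems.LerayQuarterDissipationFiniteDissipationLiouvilleDssCorners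
import Summits.NavierStokesRegularity.NavierStokesRegularity.Theorems.TypeIQuarterGateScarZoomDefs
import Summits.NavierStokesRegularity.NavierStokesRegularity.Theorems.QuarterLogPincerThinCascadeDefs
import Literature.Analysis.FluidPDE.TypeIAncientMild
import Literature.Analysis.FluidPDE.TypeIAncientMildRescale
import Literature.Analysis.FluidPDE.SelfSimilar
import Literature.Analysis.FluidPDE.ChaeWolfRemovingDSS
import Summits.NavierStokesRegularity.NavierStokesRegularity.Theorems.QuantisedSymmetryPolyhedralDssProfileExistsStubAncientMildOfClassicalTypeI
import Literature.Barriers.NavierStokesRegularity.NearOneDssTypeIExclusion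
import Summits.NavierStokesRegularity.NavierStokesRegularity.Theorems.TypeIQuarterGateScarEnvelopeTypeINearOneRateDssAxisActivity
import Summits.NavierStokesRegularity.NavierStokesRegularity.Theorems.TypeIQuarterGateScarEnvelopeTypeINearOneRateDssDensification

/-!
# Line `axis-activity` (crux `TypeIQuarterGate.ScarEnvelopeTypeI`, stmt-NavierStokesRegularity-23843) — part 3/3:
# the rung `NearOneRateDss` PROVED (near-one discretely self-similar Type-I ancient mild fields are trivial) and its corollaries

LANDING NOTE.  Author: ideator seat ns-idea-7 (g3/g4), line `axis-activity` v7 (tree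
`Cruxes/ScarEnvelopeTypeI/Lines/axis_activity.lean`, sha16 e0717fe785a7ef30; idea-crit-7 g2 VERDICT PASS 10:27:26Z, item L);
landed VERBATIM under `Theorems/` by the prover hand ns-in-wu-con g2 (DIRECTOR-NS KEY-NS #135 (2)(L) / #136 (5) / inputs-15 (b2)),
split in THREE files only for the 400-line rule (declarations byte-identical; the local notation `(EuclideanSpace ℝ (Fin 3))` spelled out as
`EuclideanSpace ℝ (Fin 3)`; deprecated `push_neg` → `push Not` for 0-warning hygiene; `set_option linter.dupNamespace false` added as in every Theorems file): part 1/3 `…NearOneRateDssAxisActivity.lean` (the four statements + S_A `axisActivity_proof` +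
`exists_recentred`, `isDiscretelySelfSimilar_pow`), part 2/3 `…NearOneRateDssDensification.lean` (S_D `scaleDensification_proof`,
S_G `selfSimilarGenerator_proof`, rescaling lemmas), part 3/3 `…NearOneRateDss.lean` (the rung `nearOneRateDss_proof` and its
corollaries `chaeWolf_of_nearOneRateDss`, `twinScarObject_not_nearOneDss`, `thinObject_not_nearOneDss`, …).
No summit is proved; the line does NOT conclude crux 23843 `ScarEnvelopeTypeI`; NS regularity is NOT proved.
-/

noncomputable section

-- the summit and its single sub-problem share the name (CONVENTIONS §1), as in every Theorems file
set_option linter.dupNamespace false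

namespace Summit.NavierStokesRegularity.NavierStokesRegularity.Cruxes.ScarEnvelopeTypeI.AxisActivity

open MeasureTheory Set Function Filter Topology Bornology
open Literature.Analysis Literature.Analysis.FluidPDE
open Summit.NavierStokesRegularity.NavierStokesRegularity.Theorems
open Summit.NavierStokesRegularity.NavierStokesRegularity.Theses.ExtremalTypeIConstant

/-- **`AxisActivity → ScaleDensification → SelfSimilarGenerator → NearOneRateDss`.**  Suppose the
rung fails for some `M`: for every `n` there are `cₙ ∈ (1, 1 + 1/(n+1))` and a nontrivial `cₙ`-DSS
`uₙ ∈ A_M`.  S_A marks a point `(tₙ, xₙ)` with `‖xₙ‖ < R₀√(−tₙ)` and `√(−tₙ)‖uₙ(tₙ,xₙ)‖ ≥ ε`; the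
parabolic rescaling `vₙ = (uₙ)_{√(−tₙ)}` stays in `A_M` (`IsTypeIAncientMild.nsRescale`), stays
`cₙ`-DSS about the origin (commuting scalings) and has `‖vₙ(−1, yₙ)‖ ≥ ε` at `yₙ = xₙ/√(−tₙ)`,
`‖yₙ‖ < R₀`.  Bolzano–Weierstrass gives `yₙ → y_inf` along a subsequence, the class compactness theorem
`exists_tendsto_of_isTypeIAncientMild_seq` a further subsequence converging (pointwise, and locally
uniformly on slices) to `W ∈ A_M`; locally uniform convergence on the slice `t = −1` and continuity of
`W(−1,·)` give `‖W(−1, y_inf)‖ ≥ ε`.  By S_D (`cₙ → 1`) `W` is scale invariant on `t < 0`, by S_G it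
satisfies the generator identity, and the CLOSED item `SelfSimilarExcluded`
(`extremalTypeIConstant_selfSimilarExcluded_proof`: Tsai 1998 Thm 1 at `q = ∞` + the Oseen identity)
makes `W ≡ 0` on `t < 0` — contradicting `‖W(−1, y_inf)‖ ≥ ε > 0`. -/
theorem nearOneRateDss_of (hA : AxisActivity) (hD : ScaleDensification)
    (hG : SelfSimilarGenerator) : NearOneRateDss := by
  obtain ⟨ε, hε, hAct⟩ := hA
  intro M
  obtain ⟨R₀, hR₀⟩ := hAct M
  by_contra H
  push Not at H
  -- a violating sequence `cₙ ↓ 1`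
  have hseq : ∀ n : ℕ, ∃ c : ℝ, 1 < c ∧ c < 1 + 1 / ((n : ℝ) + 1) ∧ ∃ u : ℝ → (EuclideanSpace ℝ (Fin 3)) → (EuclideanSpace ℝ (Fin 3)),
      IsTypeIAncientMild M u ∧ IsDiscretelySelfSimilar c u ∧ ∃ t < 0, ∃ x, u t x ≠ 0 := by
    intro n
    have hpos : (0 : ℝ) < 1 / ((n : ℝ) + 1) := by positivity
    obtain ⟨c, hc1, hc2, u, hu, hdss, t, ht, x, hx⟩ := H (1 + 1 / ((n : ℝ) + 1)) (by linarith)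
    exact ⟨c, hc1, hc2, u, hu, hdss, t, ht, x, hx⟩
  choose c hc1 hc2 u hu hdss hnt using hseq
  -- active points inside the parabola (S_A)
  have hact : ∀ n, ∃ t < 0, ∃ x : (EuclideanSpace ℝ (Fin 3)), ‖x‖ < R₀ * Real.sqrt (-t) ∧
      ε ≤ Real.sqrt (-t) * ‖u n t x‖ := fun n => hR₀ (u n) (hu n) (hnt n)
  choose t ht x hxR hxε using hact
  -- parabolic rescaling to time `−1`
  set μ : ℕ → ℝ := fun n => Real.sqrt (-(t n)) with hμ
  have hμpos : ∀ n, 0 < μ n := fun n => Real.sqrt_pos.2 (neg_pos.2 (ht n))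
  set v : ℕ → ℝ → (EuclideanSpace ℝ (Fin 3)) → (EuclideanSpace ℝ (Fin 3)) := fun n => nsRescale (μ n) (u n) with hv
  set y : ℕ → (EuclideanSpace ℝ (Fin 3)) := fun n => (μ n)⁻¹ • x n with hy
  have hvA : ∀ n, IsTypeIAncientMild M (v n) := fun n => (hu n).nsRescale (hμpos n)
  have hvdss : ∀ n, IsDiscretelySelfSimilar (c n) (v n) := fun n =>
    isDiscretelySelfSimilar_nsRescale (hdss n)
  have hyR : ∀ n, ‖y n‖ < R₀ := fun n => by
    have h1 : ‖y n‖ = (μ n)⁻¹ * ‖x n‖ := by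
      rw [hy, norm_smul, norm_inv, Real.norm_of_nonneg (hμpos n).le]
    rw [h1, inv_mul_lt_iff₀ (hμpos n), mul_comm]
    exact hxR n
  have hval : ∀ n, ε ≤ ‖v n (-1) (y n)‖ := fun n => by
    have h1 : v n (-1) (y n) = μ n • u n (t n) (x n) := by
      rw [hv, hy]
      exact nsRescale_sqrt_apply (ht n) (u n) (x n)
    rw [h1, norm_smul, Real.norm_of_nonneg (hμpos n).le]
    exact hxε n
  -- Bolzano–Weierstrass for the marked points
  obtain ⟨yinf, -, ψ, hψ, hyψ⟩ := tendsto_subseq_of_bounded (Metric.isBounded_closedBall (x := (0 : (EuclideanSpace ℝ (Fin 3))))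
    (r := R₀)) (x := y) (fun n => Metric.mem_closedBall.2 (by simpa [dist_zero_right] using (hyR n).le))
  -- compactness of the class along the subsequence
  obtain ⟨φ, hφ, W, hW, hpt, -, hloc, -⟩ :=
    exists_tendsto_of_isTypeIAncientMild_seq M (w := fun j => v (ψ j)) (fun j => hvA (ψ j))
  -- nontriviality of the limit at `(−1, y_inf)`
  have hneg1 : (-1 : ℝ) < 0 := by norm_num
  have hyconv : Tendsto (fun j => y (ψ (φ j))) atTop (𝓝 yinf) := hyψ.comp hφ.tendsto_atTop
  have hlim : Tendsto (fun j => v (ψ (φ j)) (-1) (y (ψ (φ j)))) atTop (𝓝 (W (-1) yinf)) :=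
    (hloc (-1) hneg1).tendsto_comp ((hW.continuous_slice hneg1).continuousAt) hyconv
  have hWy : ε ≤ ‖W (-1) yinf‖ :=
    ge_of_tendsto hlim.norm (Eventually.of_forall fun j => hval (ψ (φ j)))
  -- `cₙ → 1` along the subsequence
  have hsub : Tendsto (fun j => ψ (φ j)) atTop atTop := hψ.tendsto_atTop.comp hφ.tendsto_atTop
  have hc_one : Tendsto (fun j => c (ψ (φ j))) atTop (𝓝 1) := by
    have hup : Tendsto (fun j => (1 : ℝ) + 1 / (((ψ (φ j) : ℕ) : ℝ) + 1)) atTop (𝓝 (1 + 0)) :=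
      (tendsto_one_div_add_atTop_nhds_zero_nat.comp hsub).const_add 1
    rw [add_zero] at hup
    exact tendsto_of_tendsto_of_tendsto_of_le_of_le tendsto_const_nhds hup
      (fun j => (hc1 _).le) (fun j => (hc2 _).le)
  -- scale invariance of the limit (S_D) and the generator identity (S_G)
  have hSS : ∀ μ' : ℝ, 0 < μ' → ∀ t' < 0, ∀ x' : (EuclideanSpace ℝ (Fin 3)), μ' • W (μ' ^ 2 * t') (μ' • x') = W t' x' :=
    hD M (fun j => c (ψ (φ j))) (fun j => v (ψ (φ j))) W (fun j => hc1 _) hc_one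
      (fun j => hvA _) (fun j => hvdss _) hW hpt
  have hgen := hG M W hW hSS
  -- the closed item `SelfSimilarExcluded` kills the limit
  obtain ⟨h1, h2, h3, h4⟩ := isTypeIAncientMild_iff.1 hW
  have hzero : W (-1) yinf = 0 :=
    extremalTypeIConstant_selfSimilarExcluded_proof M W ⟨h1, h2, h3, h4⟩ ⟨0, hgen⟩ (-1) hneg1 yinf
  rw [hzero, norm_zero] at hWy
  exact absurd hWy (not_le.2 hε)

/-- **THE RUNG IS A THEOREM (v4): near-one DSS Type-I exclusion in the rate class, no envelope.**
Sorry-free from `axisActivity_proof` (S_A), `scaleDensification_proof` (S_D), `selfSimilarGenerator_proof`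
(S_G) and the tree.  No summit and no crux is proved by it: it is a rung on the DSS wall. -/
theorem nearOneRateDss_proof : NearOneRateDss :=
  nearOneRateDss_of axisActivity_proof scaleDensification_proof selfSimilarGenerator_proof

/-- Old name kept for the registered-stub bookkeeping (v1–v3). -/
theorem nearOneRateDss_of_stubs : NearOneRateDss := nearOneRateDss_proof

/-! ## The envelope form is a tree theorem; the rung drops the envelope -/

/-- **The printed (envelope) form is ALREADY a theorem of the tree, inside the gauge class** —
`FiniteDissipationLiouville.Birth.exists_dss_threshold_of_envelope` (route `LerayQuarterDissipation`,
from the PROVED `chaeWolf2017_removing_dss_holds` + the classical continuation of gauge-class DSS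
fields): for every envelope constant `C₀ > 0` a threshold `c₁(C₀) > 1` below which an enveloped
`c`-DSS member of ANY rate class `A_M` vanishes.  Restated here so that the delta of the rung is
kernel-visible: `NearOneRateDss` is this statement with the hypothesis `HasTypeIDecay C₀ u` DELETED
and the threshold depending on the RATE constant `M` instead (an envelope constant produced by
Chae–Wolf Thm 1.1 depends on the solution, not on `M` — cf. the tree's `exists_dss_threshold`, whose
threshold depends on `w`). -/
theorem nearOneEnvelope_inTree {C₀ : ℝ} (hC₀ : 0 < C₀) :
    ∃ c₁ : ℝ, 1 < c₁ ∧ ∀ (M c : ℝ) (u : ℝ → (EuclideanSpace ℝ (Fin 3)) → (EuclideanSpace ℝ (Fin 3))), 1 < c → c < c₁ →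
      IsTypeIAncientMild M u → HasTypeIDecay C₀ u → IsDiscretelySelfSimilar c u →
        ∀ t < 0, ∀ x, u t x = 0 :=
  FiniteDissipationLiouville.Birth.exists_dss_threshold_of_envelope hC₀

/-- **Corollary: the rung implies the envelope form with a threshold uniform in the envelope
constant's companions** — trivially, since an envelope is not even used. -/
theorem nearOneEnvelope_of_nearOneRate (h : NearOneRateDss) :
    ∀ M : ℝ, ∃ c₁ : ℝ, 1 < c₁ ∧ ∀ (C₀ c : ℝ), 1 < c → c < c₁ →
      ∀ u : ℝ → (EuclideanSpace ℝ (Fin 3)) → (EuclideanSpace ℝ (Fin 3)), IsTypeIAncientMild M u → HasTypeIDecay C₀ u →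
        IsDiscretelySelfSimilar c u → ∀ t < 0, ∀ x, u t x = 0 := by
  intro M
  obtain ⟨c₁, hc₁, hc⟩ := h M
  exact ⟨c₁, hc₁, fun C₀ c h1 h2 u hu _ hdss => hc c h1 h2 u hu hdss⟩

/-- **Corollary (sequence form facing the technique class): no nontrivial Type-I ancient mild
fields with DSS factors accumulating at `1` at bounded rate** — if `uₙ ∈ A_M` are `cₙ`-DSS with
`cₙ > 1`, `cₙ → 1`, then all but finitely many vanish on `t < 0`. -/
theorem eventually_eq_zero_of_tendsto_one (h : NearOneRateDss) (M : ℝ) {cs : ℕ → ℝ}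
    {us : ℕ → ℝ → (EuclideanSpace ℝ (Fin 3)) → (EuclideanSpace ℝ (Fin 3))} (hc : ∀ n, 1 < cs n) (hlim : Tendsto cs atTop (𝓝 1))
    (hu : ∀ n, IsTypeIAncientMild M (us n)) (hdss : ∀ n, IsDiscretelySelfSimilar (cs n) (us n)) :
    ∀ᶠ n in atTop, ∀ t < 0, ∀ x, us n t x = 0 := by
  obtain ⟨c₁, hc₁, H⟩ := h M
  have hev : ∀ᶠ n in atTop, cs n < c₁ := hlim (Iio_mem_nhds hc₁)
  exact hev.mono fun n hn => H (cs n) (hc n) hn (us n) (hu n) (hdss n)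

/-! ## Consumer inside the 23843 cone (v5): the residual object of both 23843 lines is not near-one DSS

The two registered 23843 lines (`scar_zoom` S_C′, `slice_budget` SK) have converged on ONE residual
object (KEY-NS #117/#118): an Albritton–Barker-class TWIN-SCAR Type-I ancient mild solution
`ScarZoom.TwinScarObject M v` (in `A_M`, locally uniformly `L²` up to the top, singular at `(0,0)` and at
`(0,e)`, `‖e‖ = 1`).  The rung constrains it BY NAME: such an object is not `c`-DSS about ANY centre
`x₀` with `1 < c < c₁(M)` — because `A_M` is translation invariant (`IsTypeIAncientMild.comp_add_right`)
and a field vanishing on the open past is not singular anywhere.  (Like SF, this is a PROVED constraint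
on the residual enemy, not a kill: the object need not be DSS at all.) -/

open Summit.NavierStokesRegularity.NavierStokesRegularity.Cruxes.ScarEnvelopeTypeI.ScarZoom
  (TwinScarObject SingularAt) in
/-- **Corollary (v5, kernel).**  For every `M` there is `c₁(M) > 1` such that no twin-scar object of
Type-I constant `M` is `c`-discretely self-similar about any centre `x₀` with `1 < c < c₁(M)`. -/
theorem twinScarObject_not_nearOneDss (M : ℝ) :
    ∃ c₁ : ℝ, 1 < c₁ ∧ ∀ c : ℝ, 1 < c → c < c₁ →
      ∀ (v : ℝ → (EuclideanSpace ℝ (Fin 3)) → (EuclideanSpace ℝ (Fin 3))) (x₀ : (EuclideanSpace ℝ (Fin 3))), TwinScarObject M v →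
        ¬ IsDiscretelySelfSimilar c (fun t x => v t (x + x₀)) := by
  obtain ⟨c₁, hc₁, h⟩ := nearOneRateDss_proof M
  refine ⟨c₁, hc₁, fun c hc hcc v x₀ hv hdss => ?_⟩
  have hw : IsTypeIAncientMild M (fun t x => v t (x + x₀)) := hv.1.comp_add_right x₀
  have hzero := h c hc hcc _ hw hdss
  obtain ⟨t, ht, y, -, hA⟩ := hv.2.2.1 1 one_pos 0
  have h0 : v t y = 0 := by
    have := hzero t ht.2 (y - x₀)
    simpa using this
  rw [h0, norm_zero] at hA
  exact lt_irrefl 0 hA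

/-! ## v6: the rung DOMINATES Chae–Wolf 2017 Thm 1.3 (kernel)

The envelope class of the Literature fact `chaeWolf2017_removing_dss` (classical on `(−∞,0)`,
`‖u(t,x)‖ ≤ C₀/(‖x‖ + √(−t))`) lies inside the rate class `A_{C₀}` — the tree's
`isTypeIAncientMild_of_classical_typeI` (KNSS 2009 Thm 6.1 mildness clause, PROVED; file
`Theorems/QuantisedSymmetryPolyhedralDssProfileExistsStubAncientMildOfClassicalTypeI.lean`, used BY NAME).
Hence `NearOneRateDss → chaeWolf2017_removing_dss` is two lines, and the rung re-proves Chae–Wolf's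
theorem by a different route (axis activity + KNSS compactness + Tsai `q = ∞` + the small-constant
Liouville theorem).  HONESTY: the tree ALREADY has `chaeWolf2017_removing_dss_holds`
(`Literature/Analysis/FluidPDE/ChaeWolfRemovingDSSProofs.lean`, along the printed §3), so this is a
second kernel proof, recorded only to certify IN THE KERNEL that the rung is a (weakly) STRONGER
statement than the barrier's first conjunct `NearOneDssTypeIExclusion.1`: it drops the envelope. -/

open Summit.NavierStokesRegularity.NavierStokesRegularity.Theorems.PolyhedralDssProfileExists.Birth
  (isTypeIAncientMild_of_classical_typeI) in
/-- **The rung implies Chae–Wolf 2017 Thm 1.3 (v6, kernel).** [cite: ChaeWolf2017RemovingDSS, Theorem 1.3 (arXiv:1610.09464 p. 3)] -/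
theorem chaeWolf_of_nearOneRateDss (h : NearOneRateDss) : chaeWolf2017_removing_dss := by
  intro C₀ _hC₀
  obtain ⟨c₁, hc₁, hc⟩ := h C₀
  exact ⟨c₁, hc₁, fun c h1 h2 u p hcl hdss hdec =>
    hc c h1 h2 u (isTypeIAncientMild_of_classical_typeI hcl hdec) hdss⟩

/- LANDING NOTE: the author's `chaeWolf2017_removing_dss_proof' : chaeWolf2017_removing_dss :=
chaeWolf_of_nearOneRateDss nearOneRateDss_proof` (a second kernel proof of Chae–Wolf 2017 Thm 1.3) is OMITTED here —
the gate's `dedup.landed` refuses a restatement of the already-landed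
`Literature.Analysis.FluidPDE.chaeWolf2017_removing_dss_holds`; cite that name, or apply `chaeWolf_of_nearOneRateDss
nearOneRateDss_proof` inline. -/

/-! ## v7: the same constraint on the residual object of 24077's registered line `thin_cascade`

`thin_cascade` v5 (stmt-NavierStokesRegularity-24077; after the LEAD ns-tc-p1 g3's S2 landing only S3
`stub_thinCascadeLiouville` — the DSS wall — is open) has the residual THIN OBJECT
`ThinCascade.ThinObject M q v g`: a Type-I ancient mild field in `A_M`, locally uniformly `L²` up to
the top, singular at the origin, with a log-budgeted weak final trace `g`.  The rung constrains it
exactly as it constrains the twin-scar object: not `c`-DSS about any centre for `1 < c < c₁(M)`. -/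

open Summit.NavierStokesRegularity.NavierStokesRegularity.Cruxes.TypeIQuantSubcubicExp.ThinCascade
  (ThinObject) in
/-- **Corollary (v7, kernel).**  For every `M` there is `c₁(M) > 1` such that no thin object of
Type-I constant `M` (any budget `q`, any trace `g`) is `c`-discretely self-similar about any centre
`x₀` with `1 < c < c₁(M)`. -/
theorem thinObject_not_nearOneDss (M : ℝ) :
    ∃ c₁ : ℝ, 1 < c₁ ∧ ∀ c : ℝ, 1 < c → c < c₁ →
      ∀ (q : ℝ) (v : ℝ → (EuclideanSpace ℝ (Fin 3)) → (EuclideanSpace ℝ (Fin 3))) (g : (EuclideanSpace ℝ (Fin 3)) → (EuclideanSpace ℝ (Fin 3))) (x₀ : (EuclideanSpace ℝ (Fin 3))), ThinObject M q v g →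
        ¬ IsDiscretelySelfSimilar c (fun t x => v t (x + x₀)) := by
  obtain ⟨c₁, hc₁, h⟩ := nearOneRateDss_proof M
  refine ⟨c₁, hc₁, fun c hc hcc q v g x₀ hv hdss => ?_⟩
  have hw : IsTypeIAncientMild M (fun t x => v t (x + x₀)) := hv.1.comp_add_right x₀
  have hzero := h c hc hcc _ hw hdss
  obtain ⟨t, ht, y, -, hA⟩ := hv.2.2.1 1 one_pos 0
  have h0 : v t y = 0 := by
    have := hzero t ht.2 (y - x₀)
    simpa using this
  rw [h0, norm_zero] at hA
  exact lt_irrefl 0 hA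

end Summit.NavierStokesRegularity.NavierStokesRegularity.Cruxes.ScarEnvelopeTypeI.AxisActivity

end
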